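import Literature.NumberTheory.EllipticCurves.Kobayashi2003.SignedSelmer
import HarnessLib

/-!
# Equivariant homomorphisms of local points preserve Kobayashi's signed subgroups — for the crux `SignedTransportAtTwo`
# (stmt-BirchSwinnertonDyer-20333, route `ThetaPartnerAtTwo`, line `bridge` v15: the composition `sel2Ta_of_Tb`)
# (lead prover bsd-wall-tp2-p1 g4; `--supports stmt-BirchSwinnertonDyer-20333`; route-independent, closes nothing)

HONEST FRAMING. THEOREMS ONLY (no definition); nothing about any curve is asserted; BSD is not proved by any of this.
No import of any route file.

WHAT. For any field `K`, `ℤ_p`-extension `κ`, `K`-embedding `ι : K̄ → K̄_E`, curves `W, A` and a `Γ_E`-equivariant homomorphism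
`Ψ : W(K̄_E) →+ A(K̄_E)`: `Ψ` maps `W(K_n·E)` into `A(K_n·E)` (`map_localLayerPointsOfEmb_le`), commutes with Kobayashi's traces
`Tr_{n/m}` (`map_localTraceOfEmb`), hence maps `W^ε(K_n·E)` into `A^ε(K_n·E)` (`map_signedLocalPointsOfEmb_le`; Kobayashi Def. 1.1).
This makes the trace clause of the local transport stub automatic: v15's `stub_sel2Tb` asks only for an equivariant `Ψ` restricting
to the residual isomorphism `ẽ`.

References: [Kobayashi2003] Def. 1.1; [BDKim2009] Prop. 2.11–2.12.
-/

set_option autoImplicit false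
-- D-0017: single-problem summit, so `Summit.BirchSwinnertonDyer.BirchSwinnertonDyer.…` repeats a namespace BY DESIGN.
set_option linter.dupNamespace false

noncomputable section

open scoped Classical

open WeierstrassCurve NumberField Literature Literature.NumberTheory.EllipticCurves
  Literature.NumberTheory.GaloisRepresentations Literature.NumberTheory.EllipticCurves.Kobayashi2003 ZpExtension

namespace Summit.BirchSwinnertonDyer.BirchSwinnertonDyer.Theorems.SignedTransportAtTwo

universe u

section Signed

variable {K : Type u} [Field K] {p : ℕ} [Fact p.Prime] (κ : ZpExtension K p)
  {E : Type u} [Field E] [Algebra K E] (ι : AlgebraicClosure K →ₐ[K] AlgebraicClosure E)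
  (W A : WeierstrassCurve K) (Ψ : localPoints W E →+ localPoints A E)
  (hΨ : ∀ (τ : Field.absoluteGaloisGroup E) (P : localPoints W E), Ψ (τ • P) = τ • Ψ P)
include hΨ

/-- An equivariant homomorphism of local points carries `W(K_n·E)` into `A(K_n·E)` (fixed points to fixed points).
[cite: Kobayashi2003, Def. 1.1] -/
theorem map_localLayerPointsOfEmb_le (n : ℕ) :
    (localLayerPointsOfEmb κ ι W n).map Ψ ≤ localLayerPointsOfEmb κ ι A n := by
  rintro _ ⟨P, hP, rfl⟩
  have hP' := (mem_localLayerPointsOfEmb_iff κ ι W n P).mp hP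
  rw [mem_localLayerPointsOfEmb_iff]
  intro τ hτ
  rw [← hΨ, hP' τ hτ]

/-- An equivariant homomorphism of local points commutes with Kobayashi's traces `Tr_{n/m}` (same coset representatives on both
sides). [cite: Kobayashi2003, Def. 1.1] -/
theorem map_localTraceOfEmb (m n : ℕ) (P : localPoints W E) :
    Ψ (localTraceOfEmb κ ι W m n P) = localTraceOfEmb κ ι A m n (Ψ P) := by
  haveI : Fintype (localLayerSubgroupOfEmb κ ι m ⧸
      (localLayerSubgroupOfEmb κ ι n).subgroupOf (localLayerSubgroupOfEmb κ ι m)) := Fintype.ofFinite _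
  rw [localTraceOfEmb_apply, localTraceOfEmb_apply, map_sum]
  exact Finset.sum_congr rfl fun q _ ↦ hΨ _ _

/-- **An equivariant homomorphism of local points carries Kobayashi's `E^ε(K_n·E)` for `W` into the one for `A`**: the defining
trace conditions are preserved (`map_localTraceOfEmb`, `map_localLayerPointsOfEmb_le`). This makes the trace clause of the local
transport stub automatic. [cite: Kobayashi2003, Def. 1.1] -/
theorem map_signedLocalPointsOfEmb_le (ε : ℤˣ) (n : ℕ) :
    (signedLocalPointsOfEmb κ ι W ε n).map Ψ ≤ signedLocalPointsOfEmb κ ι A ε n := by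
  rintro _ ⟨P, hP, rfl⟩
  have hP' := (mem_signedLocalPointsOfEmb_iff κ ι W ε n P).mp hP
  rw [mem_signedLocalPointsOfEmb_iff]
  refine ⟨map_localLayerPointsOfEmb_le κ ι W A Ψ hΨ n ⟨P, hP'.1, rfl⟩, fun m hm hε ↦ ?_⟩
  rw [← map_localTraceOfEmb κ ι W A Ψ hΨ]
  exact map_localLayerPointsOfEmb_le κ ι W A Ψ hΨ m ⟨_, hP'.2 m hm hε, rfl⟩

end Signed

end Summit.BirchSwinnertonDyer.BirchSwinnertonDyer.Theorems.SignedTransportAtTwo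

end
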